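import Mathlib
import Literature.MathematicalPhysics.QuantumLattice.WilsonDiracAP
import Summits.QuantumFields.QCD.Theorems.QuarksAsStableActionWilsonQuarkStabilityStubCellGauge
import Summits.QuantumFields.QCD.Theorems.QuarksAsStableActionCriticalLineDiamagnetismStubCellIncidence
import Summits.QuantumFields.QCD.Theorems.QuarksAsStableActionCriticalLineDiamagnetismStubFreeDetFormula

/-!
# The one-cell gain: from the cell gauge to the plaquette hypothesis
(helper for crux stmt-QuantumFields-9734, line `Sketch`, stub `stub_cellGain_of_gauged`)

Glue lemma `(CellGainGauged) → (CellGain)` of the chessboard / cell-gain line.  Suppose the one-cell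
gain `Re det_AP[tile_c V] ≤ exp(K₀ − c (L⁴/4) Σ_{p ∈ cell c} dfc V p) ‖det_AP[1]‖` is known whenever the
`32` LINKS of the closed unit cell at `c` have deficit `3 − Re tr V_e ≤ η`.  Then it holds whenever the
`24` PLAQUETTES of the cell have deficit `< δ₀ := η / (24 · max C_B 1)`, with the same `c, K₀, ε` and
`L₀ := max L₀ 4`.  Proof.
(1) By the landed cell gauge of the sibling line
(`…WilsonQuarkStability.FreeTangentLandauChessboard.stub_cellGauge`, `C_B = 1920`) some gauge `g` makes
the total deficit of the 32 cell links of `W := V^g` at most `C_B ×` the total deficit of the 24 cell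
plaquettes; the latter are `δ₀`-good (the sibling's `val`-filter describes plaquettes of the cell,
`card ≤ 24` by `card_le_of_subset_cell`), deficits are `≥ 0`, so every cell link of `W` has deficit
`≤ max(C_B, 1) · 24 δ₀ = η` and the gauged gain applies to `W`.
(2) Plaquette deficits are gauge invariant (`(V^g)_p = g(x) V_p g(x)⁻¹`, cyclicity of the trace).
(3) FOLD IDENTITY (even `L`): `tile_c (V^g) = (tile_c V)^{g ∘ fold_c}`, `fold_c x = c + ((x − c) mod 2)`
(re-proved from the sibling file `…WilsonQuarkStabilityStubTilingStability`), the seam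
`val x_μ + 1 = L` is the tree's `apTwistAt (fun _ => -1)`, which commutes with gauge transformations
(`apTwistAt_gaugeTransform`), and the Wilson fermion determinant is gauge invariant
(`fermionDet_wilsonDirac_gaugeTransform`); hence `det_AP[tile_c (V^g)] = det_AP[tile_c V]`.
Pure theorem file (no definitions); imports: Mathlib, the tree (`WilsonDiracAP`), the sibling line's
landed `…WilsonQuarkStabilityStubCellGauge` and this line's landed `…StubCellIncidence`,
`…StubFreeDetFormula`.  The glue at fixed `L` (`CellGainOfGauged.cellGain_glue`) is stated abstractly in
the items' `dAP`/`tile`/`dfc`/`inCell` (by defining equations) and in the three Finsets involved, so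
that Finsets elaborated in other files (decidability instances!) are matched by unification only.
-/

noncomputable section

open scoped BigOperators Classical Matrix ComplexConjugate
open Finset
open Literature.MathematicalPhysics.QuantumLattice Literature.MathematicalPhysics.QuantumFieldTheory
  Literature.Probability.LatticeModels

namespace Summit.QuantumFields.QCD.Cruxes.CriticalLineDiamagnetism.ChessboardCellGain

namespace CellGainOfGauged

variable {L : ℕ}

/-! ### Deficits and `ZMod` bookkeeping -/

/-- `Re tr u ≤ 3` on `U(3)`: link and plaquette deficits are non-negative. -/
theorem deficit_nonneg (u : Matrix.unitaryGroup (Fin 3) ℂ) :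
    0 ≤ 3 - ((u : Matrix (Fin 3) (Fin 3) ℂ)).trace.re := by
  -- adapted from `deficit_nonneg` of `QuarksAsStableActionWilsonQuarkStabilityStubTilingStability.lean`
  rw [sub_nonneg, Matrix.trace, Complex.re_sum]
  calc ∑ i, (Matrix.diag (u : Matrix (Fin 3) (Fin 3) ℂ) i).re
      ≤ ∑ _i : Fin 3, (1 : ℝ) := Finset.sum_le_sum fun i _ =>
        (Complex.re_le_norm _).trans (entry_norm_bound_of_unitary u.2 i i)
    _ = 3 := by simp

/-- `val (x - c) = 0` forces `x = c` in `ZMod L`. -/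
theorem eq_of_val_sub_eq_zero {x c : ZMod L} (h : (x - c).val = 0) : x = c :=
  sub_eq_zero.1 ((ZMod.val_eq_zero _).1 h)

/-- `val (x - c) ≤ 1` forces `x ∈ {c, c + 1}` in `ZMod L` (`L ≥ 1`). -/
theorem eq_or_eq_add_one_of_val_sub_le_one [NeZero L] {x c : ZMod L} (h : (x - c).val ≤ 1) :
    x = c ∨ x = c + 1 := by
  rcases Nat.le_one_iff_eq_zero_or_eq_one.1 h with h0 | h1
  · exact Or.inl (eq_of_val_sub_eq_zero h0)
  · refine Or.inr (sub_eq_iff_eq_add'.1 ?_)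
    rw [← ZMod.natCast_zmod_val (x - c), h1, Nat.cast_one]

/-- Membership in a filtered `univ`, the `Fintype`/decidability instances being taken from the term
(so that Finsets elaborated in other files are matched by unification, not by instance synthesis). -/
theorem mem_filter_univ_of {α : Type*} {instF : Fintype α} {p : α → Prop} {inst : DecidablePred p}
    {a : α} (h : p a) : a ∈ @Finset.filter α p inst (@Finset.univ α instF) :=
  Finset.mem_filter.2 ⟨Finset.mem_univ _, h⟩

/-- The predicate of a filtered `univ` holds on its members (instances taken from the term). -/
theorem of_mem_filter_univ {α : Type*} {instF : Fintype α} {p : α → Prop} {inst : DecidablePred p}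
    {a : α} (h : a ∈ @Finset.filter α p inst (@Finset.univ α instF)) : p a :=
  (Finset.mem_filter.1 h).2

/-- On an even torus the parity of `val` is additive under `+1` (the wrap `L - 1 ↦ 0` is
`odd ↦ even`). -/
theorem zmod_val_add_one_mod_two [NeZero L] (hL : Even L) (a : ZMod L) :
    (a + 1).val % 2 = (a.val + 1) % 2 := by
  -- adapted from `zmod_val_add_one_mod_two` of `…WilsonQuarkStabilityStubTilingStability.lean`
  have hL1 : L ≠ 1 := by rintro rfl; exact Nat.not_even_one hL
  rw [ZMod.val_add, ZMod.val_one'' hL1]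
  exact Nat.mod_mod_of_dvd _ (even_iff_two_dvd.1 hL)

/-! ### Gauge invariance of plaquette traces and of the seam-twisted determinant -/

/-- Under `U ↦ U^g` the plaquette holonomy is conjugated by `g(x)`, so `tr ρ(U^g_p) = tr ρ(U_p)`. -/
theorem trace_plaquetteHolonomy_gaugeTransform {d N : ℕ} {G : Type*} [Group G]
    (ρ : G →* Matrix (Fin N) (Fin N) ℂ) (g : Site d L → G) (U : GaugeConfig d L G) (x : Site d L)
    (i j : Fin d) :
    (ρ (plaquetteHolonomy (gaugeTransform g U) x i j)).trace = (ρ (plaquetteHolonomy U x i j)).trace := by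
  -- adapted from the proof of `wilsonAction_gaugeTransform` (Literature/…/ConstructiveQFTWave0.lean)
  have hshift : (x.shift j).shift i = (x.shift i).shift j := by
    simp only [Literature.MathematicalPhysics.QuantumFieldTheory.Site.shift, add_assoc,
      add_comm (Pi.single (M := fun _ => ZMod L) j 1)]
  have hhol : plaquetteHolonomy (gaugeTransform g U) x i j =
      g x * plaquetteHolonomy U x i j * (g x)⁻¹ := by
    simp only [plaquetteHolonomy, gaugeTransform, hshift, mul_inv_rev, inv_inv]
    group
  rw [hhol, map_mul, map_mul, Matrix.trace_mul_cycle, ← map_mul, inv_mul_cancel, map_one, one_mul]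

/-- The items' seam `val x_μ + 1 = L` is the tree's sign twist `apTwistAt (fun _ => -1)`. -/
theorem seam_eq_apTwistAt [NeZero L] (W : GaugeConfig 4 L (Matrix.unitaryGroup (Fin 3) ℂ)) :
    (fun e : Edge 4 L => if (e.1 e.2).val + 1 = L then -W e else W e) =
      apTwistAt (fun _ => (-1 : ZMod L)) W := by
  -- adapted from `seam_eq_apTwistAt'` of `…CriticalLineDiamagnetismStubQuarkChessboardOfSchwarzAux2.lean`
  funext e
  rw [apTwistAt_apply]
  by_cases h : e.1 e.2 = -1
  · rw [if_pos ((FreeDetFormula.val_add_one_eq_iff _).2 h), if_pos h]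
  · rw [if_neg (fun h' => h ((FreeDetFormula.val_add_one_eq_iff _).1 h')), if_neg h]

/-- **Gauge invariance of the antiperiodic Wilson determinant** (`U(3)` links, seam `val x_μ + 1 = L`):
the seam twist commutes with gauge transformations (`-1` is central) and `det D_W[U^g] = det D_W[U]`. -/
theorem det_seam_gaugeTransform [NeZero L] (g : Site 4 L → Matrix.unitaryGroup (Fin 3) ℂ)
    (W : GaugeConfig 4 L (Matrix.unitaryGroup (Fin 3) ℂ)) (m : ℝ) :
    (wilsonDirac (unitaryFundamentalRep (Fin 3) ℂ)
        (fun e => if (e.1 e.2).val + 1 = L then -(gaugeTransform g W e) else gaugeTransform g W e)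
        m 1).det =
      (wilsonDirac (unitaryFundamentalRep (Fin 3) ℂ)
        (fun e => if (e.1 e.2).val + 1 = L then -W e else W e) m 1).det := by
  rw [seam_eq_apTwistAt (gaugeTransform g W), seam_eq_apTwistAt W, apTwistAt_gaugeTransform]
  exact fermionDet_wilsonDirac_gaugeTransform _ g _ m 1

/-! ### The fold identity for the period-2 reflection tiling (even `L`) -/

/-- The fold `x ↦ c + ((x - c) mod 2)` commutes with the shift `+μ̂` at sites of even
`μ`-offset (even `L`). -/
theorem fold_shift_of_even [NeZero L] (hL : Even L) (c x : Site 4 L) (μ : Fin 4)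
    (h : (x μ - c μ).val % 2 = 0) :
    (fun ν => c ν + (((Site.shift x μ ν - c ν).val % 2 : ℕ) : ZMod L)) =
      Site.shift (fun ν => c ν + (((x ν - c ν).val % 2 : ℕ) : ZMod L)) μ := by
  -- adapted from `fold_shift_of_even` of `…WilsonQuarkStabilityStubTilingStability.lean`
  funext ν
  by_cases hν : ν = μ
  · subst hν
    have h1 : ((x ν - c ν).val + 1) % 2 = 1 := by omega
    rw [FreeDetFormula.shift_apply_self, FreeDetFormula.shift_apply_self, add_sub_right_comm,
      zmod_val_add_one_mod_two hL, h, h1, Nat.cast_one, Nat.cast_zero, add_zero]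
  · rw [FreeDetFormula.shift_apply_of_ne x hν, FreeDetFormula.shift_apply_of_ne _ hν]

/-- ... and is undone by the shift `+μ̂` at sites of odd `μ`-offset (even `L`). -/
theorem shift_fold_shift_of_odd [NeZero L] (hL : Even L) (c x : Site 4 L) (μ : Fin 4)
    (h : ¬(x μ - c μ).val % 2 = 0) :
    Site.shift (fun ν => c ν + (((Site.shift x μ ν - c ν).val % 2 : ℕ) : ZMod L)) μ =
      fun ν => c ν + (((x ν - c ν).val % 2 : ℕ) : ZMod L) := by
  -- adapted from `shift_fold_shift_of_odd` of `…WilsonQuarkStabilityStubTilingStability.lean`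
  funext ν
  by_cases hν : ν = μ
  · subst hν
    have h1 : (x ν - c ν).val % 2 = 1 := by omega
    have h0 : ((x ν - c ν).val + 1) % 2 = 0 := by omega
    rw [FreeDetFormula.shift_apply_self, FreeDetFormula.shift_apply_self, add_sub_right_comm,
      zmod_val_add_one_mod_two hL, h0, h1, Nat.cast_one, Nat.cast_zero, add_zero]
  · rw [FreeDetFormula.shift_apply_of_ne _ hν, FreeDetFormula.shift_apply_of_ne x hν]

/-- **The fold identity** for the period-2 reflection tiling `tile_c` (even `L`), explicit form:
`(tile_c V)^{g ∘ fold_c} = tile_c (V^g)`. -/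
theorem gaugeTransform_tile [NeZero L] (hL : Even L)
    (g : Site 4 L → Matrix.unitaryGroup (Fin 3) ℂ)
    (V : GaugeConfig 4 L (Matrix.unitaryGroup (Fin 3) ℂ)) (c : Site 4 L) :
    gaugeTransform (fun x => g (fun ν => c ν + (((x ν - c ν).val % 2 : ℕ) : ZMod L)))
        (fun e => if (e.1 e.2 - c e.2).val % 2 = 0
          then V (fun ν => c ν + (((e.1 ν - c ν).val % 2 : ℕ) : ZMod L), e.2)
          else (V (fun ν => c ν + (((Site.shift e.1 e.2 ν - c ν).val % 2 : ℕ) : ZMod L), e.2))⁻¹) =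
      fun e : Edge 4 L => if (e.1 e.2 - c e.2).val % 2 = 0
          then gaugeTransform g V (fun ν => c ν + (((e.1 ν - c ν).val % 2 : ℕ) : ZMod L), e.2)
          else (gaugeTransform g V
            (fun ν => c ν + (((Site.shift e.1 e.2 ν - c ν).val % 2 : ℕ) : ZMod L), e.2))⁻¹ := by
  -- adapted from `gaugeTransform_tile` of `…WilsonQuarkStabilityStubTilingStability.lean`
  funext e
  simp only [gaugeTransform]
  split_ifs with h
  · rw [fold_shift_of_even hL c e.1 e.2 h]
  · rw [_root_.mul_inv_rev, _root_.mul_inv_rev, inv_inv, shift_fold_shift_of_odd hL c e.1 e.2 h,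
      mul_assoc]

/-- **The fold identity**, for any `tile` satisfying the defining equation of the items' tiling:
`tile_c (V^g) = (tile_c V)^{g ∘ fold_c}` (even `L`). -/
theorem tile_gaugeTransform [NeZero L] (hL : Even L)
    {tile : Site 4 L → GaugeConfig 4 L (Matrix.unitaryGroup (Fin 3) ℂ) →
      GaugeConfig 4 L (Matrix.unitaryGroup (Fin 3) ℂ)}
    (htile : ∀ (c : Site 4 L) (V : GaugeConfig 4 L (Matrix.unitaryGroup (Fin 3) ℂ)) (e : Edge 4 L),
      tile c V e = if (e.1 e.2 - c e.2).val % 2 = 0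
        then V (fun ν => c ν + (((e.1 ν - c ν).val % 2 : ℕ) : ZMod L), e.2)
        else (V (fun ν => c ν + (((Site.shift e.1 e.2 ν - c ν).val % 2 : ℕ) : ZMod L), e.2))⁻¹)
    (g : Site 4 L → Matrix.unitaryGroup (Fin 3) ℂ) (V : GaugeConfig 4 L (Matrix.unitaryGroup (Fin 3) ℂ))
    (c : Site 4 L) :
    tile c (gaugeTransform g V) =
      gaugeTransform (fun x => g (fun ν => c ν + (((x ν - c ν).val % 2 : ℕ) : ZMod L))) (tile c V) := by
  have hV : tile c V = fun e : Edge 4 L => if (e.1 e.2 - c e.2).val % 2 = 0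
      then V (fun ν => c ν + (((e.1 ν - c ν).val % 2 : ℕ) : ZMod L), e.2)
      else (V (fun ν => c ν + (((Site.shift e.1 e.2 ν - c ν).val % 2 : ℕ) : ZMod L), e.2))⁻¹ :=
    funext (htile c V)
  rw [hV, gaugeTransform_tile hL g V c]
  exact funext (htile c (gaugeTransform g V))

/-! ### The glue at fixed even `L` -/

/-- **The glue at fixed `L`** (abstract in the items' `dAP`, `tile`, `dfc`, `inCell`, given by their
defining equations, in the two cell Finsets `EF`, `PF` of the sibling cell gauge and in the Finset `CF`
of the exponent).  If `g` is a cell gauge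
(`Σ_{cell links} deficit(V^g) ≤ C_B Σ_{cell plaquettes} deficit(V)`), the gauged one-cell gain holds at
link threshold `η`, and the cell plaquettes of `V` are `η / (24 max(C_B,1))`-good, then the one-cell
gain holds for `V`. -/
theorem cellGain_glue [NeZero L] (hL : Even L) {η c K₀ CB m : ℝ} (hη : 0 < η)
    {dAP : GaugeConfig 4 L (Matrix.unitaryGroup (Fin 3) ℂ) → ℝ → ℂ}
    (hdAP : ∀ (V : GaugeConfig 4 L (Matrix.unitaryGroup (Fin 3) ℂ)) (m : ℝ), dAP V m =
      (wilsonDirac (unitaryFundamentalRep (Fin 3) ℂ)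
        (fun e => if (e.1 e.2).val + 1 = L then -V e else V e) m 1).det)
    {tile : Site 4 L → GaugeConfig 4 L (Matrix.unitaryGroup (Fin 3) ℂ) →
      GaugeConfig 4 L (Matrix.unitaryGroup (Fin 3) ℂ)}
    (htile : ∀ (c : Site 4 L) (V : GaugeConfig 4 L (Matrix.unitaryGroup (Fin 3) ℂ)) (e : Edge 4 L),
      tile c V e = if (e.1 e.2 - c e.2).val % 2 = 0
        then V (fun ν => c ν + (((e.1 ν - c ν).val % 2 : ℕ) : ZMod L), e.2)
        else (V (fun ν => c ν + (((Site.shift e.1 e.2 ν - c ν).val % 2 : ℕ) : ZMod L), e.2))⁻¹)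
    {dfc : GaugeConfig 4 L (Matrix.unitaryGroup (Fin 3) ℂ) → Plaquette 4 L → ℝ}
    (hdfc : ∀ (V : GaugeConfig 4 L (Matrix.unitaryGroup (Fin 3) ℂ)) (p : Plaquette 4 L), dfc V p =
      3 - (unitaryFundamentalRep (Fin 3) ℂ (plaquetteHolonomy V p.1 p.2.1.1 p.2.1.2)).trace.re)
    {inCell : Site 4 L → Plaquette 4 L → Prop}
    (hinCell : ∀ (c : Site 4 L) (p : Plaquette 4 L), inCell c p ↔
      (p.1 p.2.1.1 = c p.2.1.1 ∧ p.1 p.2.1.2 = c p.2.1.2 ∧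
        ∀ ν, ν ≠ p.2.1.1 → ν ≠ p.2.1.2 → (p.1 ν = c ν ∨ p.1 ν = c ν + 1)))
    (V : GaugeConfig 4 L (Matrix.unitaryGroup (Fin 3) ℂ)) (cell : Site 4 L)
    (g : Site 4 L → Matrix.unitaryGroup (Fin 3) ℂ)
    {EF : Finset (Edge 4 L)} {PF : Finset (Plaquette 4 L)}
    (hg : (∑ e ∈ EF, (3 - (((gaugeTransform g V e : Matrix.unitaryGroup (Fin 3) ℂ) :
        Matrix (Fin 3) (Fin 3) ℂ)).trace.re)) ≤
      CB * ∑ p ∈ PF, (3 - (((plaquetteHolonomy V p.1 p.2.1.1 p.2.1.2 : Matrix.unitaryGroup (Fin 3) ℂ) :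
        Matrix (Fin 3) (Fin 3) ℂ)).trace.re))
    (hEF : ∀ e : Edge 4 L, ((∀ ν, (e.1 ν - cell ν).val ≤ 1) ∧ (e.1 e.2 - cell e.2).val = 0) → e ∈ EF)
    (hPF : ∀ p ∈ PF, (∀ ν, (p.1 ν - cell ν).val ≤ 1) ∧ (p.1 p.2.1.1 - cell p.2.1.1).val = 0 ∧
      (p.1 p.2.1.2 - cell p.2.1.2).val = 0)
    {CF : Finset (Plaquette 4 L)}
    (hG : ∀ W : GaugeConfig 4 L (Matrix.unitaryGroup (Fin 3) ℂ),
      (∀ e : Edge 4 L, ((∀ ν, (e.1 ν - cell ν).val ≤ 1) ∧ (e.1 e.2 - cell e.2).val = 0) →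
        3 - ((W e : Matrix.unitaryGroup (Fin 3) ℂ) : Matrix (Fin 3) (Fin 3) ℂ).trace.re ≤ η) →
      (dAP (tile cell W) m).re ≤
        Real.exp (K₀ - c * ((L : ℝ) ^ 4 / 4) * ∑ p ∈ CF, dfc W p) *
          ‖dAP 1 m‖)
    (hgood : ∀ p, inCell cell p → dfc V p < η / (24 * max CB 1)) :
    (dAP (tile cell V) m).re ≤
      Real.exp (K₀ - c * ((L : ℝ) ^ 4 / 4) * ∑ p ∈ CF, dfc V p) *
        ‖dAP 1 m‖ := by
  -- (1) the plaquettes of `PF` lie in the closed unit cell: at most `24` of them, each `δ₀`-good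
  have hPFcell : ∀ p ∈ PF, p.1 p.2.1.1 = cell p.2.1.1 ∧ p.1 p.2.1.2 = cell p.2.1.2 ∧
      ∀ κ, κ ≠ p.2.1.1 → κ ≠ p.2.1.2 → (p.1 κ = cell κ ∨ p.1 κ = cell κ + 1) := fun p hp => by
    obtain ⟨h1, h2, h3⟩ := hPF p hp
    exact ⟨eq_of_val_sub_eq_zero h2, eq_of_val_sub_eq_zero h3,
      fun κ _ _ => eq_or_eq_add_one_of_val_sub_le_one (h1 κ)⟩
  have hcard : PF.card ≤ 24 := card_le_of_subset_cell cell PF hPFcell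
  have hM : 0 < max CB 1 := lt_of_lt_of_le one_pos (le_max_right _ _)
  have hδ₀ : 0 < η / (24 * max CB 1) := by positivity
  have hS0 : 0 ≤ ∑ p ∈ PF, (3 - (((plaquetteHolonomy V p.1 p.2.1.1 p.2.1.2 :
      Matrix.unitaryGroup (Fin 3) ℂ) : Matrix (Fin 3) (Fin 3) ℂ)).trace.re) :=
    Finset.sum_nonneg fun p _ => deficit_nonneg _
  have hSle : ∑ p ∈ PF, (3 - (((plaquetteHolonomy V p.1 p.2.1.1 p.2.1.2 :
      Matrix.unitaryGroup (Fin 3) ℂ) : Matrix (Fin 3) (Fin 3) ℂ)).trace.re) ≤ 24 * (η / (24 * max CB 1)) :=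
    calc ∑ p ∈ PF, (3 - (((plaquetteHolonomy V p.1 p.2.1.1 p.2.1.2 :
          Matrix.unitaryGroup (Fin 3) ℂ) : Matrix (Fin 3) (Fin 3) ℂ)).trace.re)
        ≤ ∑ _p ∈ PF, η / (24 * max CB 1) := Finset.sum_le_sum fun p hp => by
          have h := hgood p ((hinCell cell p).2 (hPFcell p hp))
          rw [hdfc] at h
          exact h.le
      _ = PF.card * (η / (24 * max CB 1)) := by rw [Finset.sum_const, nsmul_eq_mul]
      _ ≤ 24 * (η / (24 * max CB 1)) :=
          mul_le_mul_of_nonneg_right (by exact_mod_cast hcard) hδ₀.le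
  -- (2) in the cell gauge every cell link of `W := V^g` has deficit at most `η`
  have hlinks : ∀ e : Edge 4 L, ((∀ ν, (e.1 ν - cell ν).val ≤ 1) ∧ (e.1 e.2 - cell e.2).val = 0) →
      3 - ((gaugeTransform g V e : Matrix.unitaryGroup (Fin 3) ℂ) :
        Matrix (Fin 3) (Fin 3) ℂ).trace.re ≤ η := by
    intro e he
    have h1 := Finset.single_le_sum (f := fun e : Edge 4 L =>
        3 - (((gaugeTransform g V e : Matrix.unitaryGroup (Fin 3) ℂ) :
          Matrix (Fin 3) (Fin 3) ℂ)).trace.re) (fun e _ => deficit_nonneg _) (hEF e he)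
    have h3 : max CB 1 * (24 * (η / (24 * max CB 1))) = η := by
      field_simp
    calc 3 - ((gaugeTransform g V e : Matrix.unitaryGroup (Fin 3) ℂ) : Matrix (Fin 3) (Fin 3) ℂ).trace.re
        ≤ ∑ e ∈ EF, (3 - (((gaugeTransform g V e : Matrix.unitaryGroup (Fin 3) ℂ) :
            Matrix (Fin 3) (Fin 3) ℂ)).trace.re) := h1
      _ ≤ CB * ∑ p ∈ PF, (3 - (((plaquetteHolonomy V p.1 p.2.1.1 p.2.1.2 :
            Matrix.unitaryGroup (Fin 3) ℂ) : Matrix (Fin 3) (Fin 3) ℂ)).trace.re) := hg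
      _ ≤ max CB 1 * ∑ p ∈ PF, (3 - (((plaquetteHolonomy V p.1 p.2.1.1 p.2.1.2 :
            Matrix.unitaryGroup (Fin 3) ℂ) : Matrix (Fin 3) (Fin 3) ℂ)).trace.re) :=
          mul_le_mul_of_nonneg_right (le_max_left _ _) hS0
      _ ≤ max CB 1 * (24 * (η / (24 * max CB 1))) := mul_le_mul_of_nonneg_left hSle hM.le
      _ = η := h3
  -- (3) the gauged one-cell gain for `W`
  have key := hG (gaugeTransform g V) hlinks
  -- (4) plaquette deficits are gauge invariant
  have hsum : ∑ p ∈ CF, dfc (gaugeTransform g V) p =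
      ∑ p ∈ CF, dfc V p :=
    Finset.sum_congr rfl fun p _ => by
      rw [hdfc, hdfc, trace_plaquetteHolonomy_gaugeTransform]
  -- (5) the antiperiodic determinant of the tiling is gauge invariant (fold identity + seam)
  have hdet : dAP (tile cell (gaugeTransform g V)) m = dAP (tile cell V) m := by
    rw [hdAP, hdAP, tile_gaugeTransform hL htile g V cell]
    exact det_seam_gaugeTransform _ _ m
  rw [hdet, hsum] at key
  exact key

end CellGainOfGauged

/-- **Stub 2a — `cellGain_of_gauged` (glue).**  The one-cell gain with a hypothesis on the 32 cell
LINKS (`3 − Re tr V_e ≤ η`, the link filter of the sibling cell gauge `…stub_cellGauge`) implies the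
one-cell gain with the hypothesis on the 24 cell PLAQUETTES (`dfc < δ₀`), with
`δ₀ := η / (24 · max C_B 1)`, the same `c, K₀, ε`, and `L₀ := max L₀ 4`: choose the cell gauge `g`;
the tiling of `V^g` is a gauge transform of the tiling of `V` (fold identity, even `L`), the seam twist
commutes with gauge transforms, `det` and the deficits are gauge invariant (`CellGainOfGauged.cellGain_glue`). -/
theorem stub_cellGain_of_gauged :
    (∃ η c K₀ ε : ℝ, 0 < η ∧ 0 < c ∧ 0 < ε ∧ ∃ L₀ : ℕ, ∀ (L : ℕ) [NeZero L], Even L → L₀ ≤ L →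
    let dAP : GaugeConfig 4 L (Matrix.unitaryGroup (Fin 3) ℂ) → ℝ → ℂ := fun V m =>
      (wilsonDirac (unitaryFundamentalRep (Fin 3) ℂ)
        (fun e => if (e.1 e.2).val + 1 = L then -V e else V e) m 1).det;
    let tile : Site 4 L → GaugeConfig 4 L (Matrix.unitaryGroup (Fin 3) ℂ) →
        GaugeConfig 4 L (Matrix.unitaryGroup (Fin 3) ℂ) := fun c V e =>
      if (e.1 e.2 - c e.2).val % 2 = 0 then V (fun ν => c ν + (((e.1 ν - c ν).val % 2 : ℕ) : ZMod L), e.2)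
      else (V (fun ν => c ν + (((Site.shift e.1 e.2 ν - c ν).val % 2 : ℕ) : ZMod L), e.2))⁻¹;
    let dfc : GaugeConfig 4 L (Matrix.unitaryGroup (Fin 3) ℂ) → Plaquette 4 L → ℝ := fun V p =>
      3 - (unitaryFundamentalRep (Fin 3) ℂ (plaquetteHolonomy V p.1 p.2.1.1 p.2.1.2)).trace.re;
    let inCell : Site 4 L → Plaquette 4 L → Prop := fun c p =>
      p.1 p.2.1.1 = c p.2.1.1 ∧ p.1 p.2.1.2 = c p.2.1.2 ∧
        ∀ ν, ν ≠ p.2.1.1 → ν ≠ p.2.1.2 → (p.1 ν = c ν ∨ p.1 ν = c ν + 1);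
    ∀ (V : GaugeConfig 4 L (Matrix.unitaryGroup (Fin 3) ℂ)) (cell : Site 4 L) (m : ℝ), |m| ≤ ε →
      (∀ e : Edge 4 L, ((∀ ν, (e.1 ν - cell ν).val ≤ 1) ∧ (e.1 e.2 - cell e.2).val = 0) →
        3 - ((V e : Matrix.unitaryGroup (Fin 3) ℂ) : Matrix (Fin 3) (Fin 3) ℂ).trace.re ≤ η) →
        (dAP (tile cell V) m).re ≤
          Real.exp (K₀ - c * ((L : ℝ) ^ 4 / 4) * ∑ p ∈ univ.filter (fun p => inCell cell p), dfc V p) *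
            ‖dAP 1 m‖) →
    (∃ δ₀ c K₀ ε : ℝ, 0 < δ₀ ∧ 0 < c ∧ 0 < ε ∧ ∃ L₀ : ℕ, ∀ (L : ℕ) [NeZero L], Even L → L₀ ≤ L →
    let dAP : GaugeConfig 4 L (Matrix.unitaryGroup (Fin 3) ℂ) → ℝ → ℂ := fun V m =>
      (wilsonDirac (unitaryFundamentalRep (Fin 3) ℂ)
        (fun e => if (e.1 e.2).val + 1 = L then -V e else V e) m 1).det;
    let tile : Site 4 L → GaugeConfig 4 L (Matrix.unitaryGroup (Fin 3) ℂ) →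
        GaugeConfig 4 L (Matrix.unitaryGroup (Fin 3) ℂ) := fun c V e =>
      if (e.1 e.2 - c e.2).val % 2 = 0 then V (fun ν => c ν + (((e.1 ν - c ν).val % 2 : ℕ) : ZMod L), e.2)
      else (V (fun ν => c ν + (((Site.shift e.1 e.2 ν - c ν).val % 2 : ℕ) : ZMod L), e.2))⁻¹;
    let dfc : GaugeConfig 4 L (Matrix.unitaryGroup (Fin 3) ℂ) → Plaquette 4 L → ℝ := fun V p =>
      3 - (unitaryFundamentalRep (Fin 3) ℂ (plaquetteHolonomy V p.1 p.2.1.1 p.2.1.2)).trace.re;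
    let inCell : Site 4 L → Plaquette 4 L → Prop := fun c p =>
      p.1 p.2.1.1 = c p.2.1.1 ∧ p.1 p.2.1.2 = c p.2.1.2 ∧
        ∀ ν, ν ≠ p.2.1.1 → ν ≠ p.2.1.2 → (p.1 ν = c ν ∨ p.1 ν = c ν + 1);
    ∀ (V : GaugeConfig 4 L (Matrix.unitaryGroup (Fin 3) ℂ)) (cell : Site 4 L) (m : ℝ), |m| ≤ ε →
      (∀ p, inCell cell p → dfc V p < δ₀) →
        (dAP (tile cell V) m).re ≤
          Real.exp (K₀ - c * ((L : ℝ) ^ 4 / 4) * ∑ p ∈ univ.filter (fun p => inCell cell p), dfc V p) *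
            ‖dAP 1 m‖) := by
  rintro ⟨η, c, K₀, ε, hη, hc, hε, L₀, hG⟩
  obtain ⟨CB, hB⟩ :=
    Summit.QuantumFields.QCD.Cruxes.WilsonQuarkStability.FreeTangentLandauChessboard.stub_cellGauge
  have hM : 0 < max CB 1 := lt_of_lt_of_le one_pos (le_max_right _ _)
  refine ⟨η / (24 * max CB 1), c, K₀, ε, by positivity, hc, hε, max L₀ 4, ?_⟩
  intro L _ hLeven hL dAP tile dfc inCell V cell m hm hgood
  have hL₀ : L₀ ≤ L := le_of_max_le_left hL
  have hL4 : 4 ≤ L := le_of_max_le_right hL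
  obtain ⟨g, hg⟩ := hB L hL4 V cell
  -- the defining equations of the four `let`s
  have hdAP : ∀ (V : GaugeConfig 4 L (Matrix.unitaryGroup (Fin 3) ℂ)) (m : ℝ), dAP V m =
      (wilsonDirac (unitaryFundamentalRep (Fin 3) ℂ)
        (fun e => if (e.1 e.2).val + 1 = L then -V e else V e) m 1).det := fun _ _ => rfl
  have htile : ∀ (c : Site 4 L) (V : GaugeConfig 4 L (Matrix.unitaryGroup (Fin 3) ℂ)) (e : Edge 4 L),
      tile c V e = if (e.1 e.2 - c e.2).val % 2 = 0
        then V (fun ν => c ν + (((e.1 ν - c ν).val % 2 : ℕ) : ZMod L), e.2)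
        else (V (fun ν => c ν + (((Site.shift e.1 e.2 ν - c ν).val % 2 : ℕ) : ZMod L), e.2))⁻¹ :=
    fun _ _ _ => rfl
  have hdfc : ∀ (V : GaugeConfig 4 L (Matrix.unitaryGroup (Fin 3) ℂ)) (p : Plaquette 4 L), dfc V p =
      3 - (unitaryFundamentalRep (Fin 3) ℂ (plaquetteHolonomy V p.1 p.2.1.1 p.2.1.2)).trace.re :=
    fun _ _ => rfl
  have hinCell : ∀ (c : Site 4 L) (p : Plaquette 4 L), inCell c p ↔
      (p.1 p.2.1.1 = c p.2.1.1 ∧ p.1 p.2.1.2 = c p.2.1.2 ∧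
        ∀ ν, ν ≠ p.2.1.1 → ν ≠ p.2.1.2 → (p.1 ν = c ν ∨ p.1 ν = c ν + 1)) := fun _ _ => Iff.rfl
  -- the gauged gain at this `L`, `cell`, `m`
  have hG' : ∀ W : GaugeConfig 4 L (Matrix.unitaryGroup (Fin 3) ℂ),
      (∀ e : Edge 4 L, ((∀ ν, (e.1 ν - cell ν).val ≤ 1) ∧ (e.1 e.2 - cell e.2).val = 0) →
        3 - ((W e : Matrix.unitaryGroup (Fin 3) ℂ) : Matrix (Fin 3) (Fin 3) ℂ).trace.re ≤ η) →
      (dAP (tile cell W) m).re ≤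
        Real.exp (K₀ - c * ((L : ℝ) ^ 4 / 4) * ∑ p ∈ univ.filter (fun p => inCell cell p), dfc W p) *
          ‖dAP 1 m‖ := fun W hW => hG L hLeven hL₀ W cell m hm hW
  have hglue := CellGainOfGauged.cellGain_glue (c := c) (K₀ := K₀) (m := m) hLeven hη hdAP htile hdfc
    hinCell V cell g hg
  refine hglue (fun e he => ?_) (fun p hp => ?_) hG' hgood
  · exact CellGainOfGauged.mem_filter_univ_of he
  · exact (CellGainOfGauged.of_mem_filter_univ hp :)

end Summit.QuantumFields.QCD.Cruxes.CriticalLineDiamagnetism.ChessboardCellGain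

end
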